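import Literature.Analysis.FluidPDE.LocalTypeI
import Literature.Analysis.FluidPDE.SuitableWeakRescaling
import HarnessLib

/-!
# Albritton–Barker 2020, Thm. 3.1 (interior case, Rmk. 3.4): local regularity at the terminal
# time under weak-`L³` control along a sequence of times

Topic `Analysis/FluidPDE`. Source: D. Albritton, T. Barker, *Localised necessary conditions for
singularity formation in the Navier–Stokes equations with curved boundary*, J. Differential
Equations 269 (2020), no. 9, 7529–7573, doi:10.1016/j.jde.2020.06.009 = arXiv:1811.00507
[`AlbrittonBarker2020`]; read in the held arXiv text (`paper:arxiv-1811.00507`: Def. 2.1 = §2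
c6, Thm. 3.1 = §3 c9, Rmk. 3.4 = c13; the journal numbering agrees).

## The printed statements (`ν = 1`, no force)

* **Definition 2.1** (boundary suitable weak solution in `Q_I = Ω × I`, `I = ]S,T[`, vanishing on
  a relatively open `Γ ⊆ ∂Ω`; the arXiv text misprints `Ω̄' ⊂ Ω ⊂ Γ` for `Ω̄' ⊂ Ω ∪ Γ`): for all
  bounded subdomains `Ω' ⋐ Ω ∪ Γ` and `S < S' < T`,
  `v ∈ L_{2,∞} ∩ W^{1,0}_2(Ω' × ]S',T[)`, `q ∈ L_{3/2}(Ω' × ]S',T[)`, `v|_Γ = 0`; `(v,q)` solves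
  the Navier–Stokes equations in `Q_I` in the sense of distributions; and the local energy
  inequality `∫_Ω ζ|v(x,t)|² + 2∫₀ᵗ∫_Ω ζ|∇v|² ≤ ∫₀ᵗ∫_Ω |v|²(∂ₜζ + Δζ) + (|v|² + 2q)v·∇ζ` holds
  for all non-negative `ζ ∈ C₀^∞((Ω ∪ Γ) × ]S,T])` and a.e. `t ∈ I` (footnote: "since
  `v ∈ C_w([0,T];L²(Ω))`, the local energy inequality is actually satisfied for every `t ∈ I`" —
  the slices `v(·,t)` are those of the weakly continuous representative).
* **Theorem 3.1** (behaviour of the `L₃^weak` norm). Let `Ω ⊂ ℝ³` be a bounded `C²` domain,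
  `Γ ⊂ ∂Ω` relatively open, `x* ∈ Ω ∪ Γ` and `R > 0` with `Ω̄_{x*,R} ⊂ Ω ∪ Γ`
  (`Ω_{x*,R} = Ω ∩ B(x*,R)`). For each `M > 0` there exists `ε = ε(Ω,M) > 0` such that: if `v` is
  a boundary suitable weak solution in `Ω × ]0,1[` vanishing on `Γ` with
  `v ∈ L_∞(Ω × ]0,t[)` for all `0 < t < 1`, if there is a sequence `t_k ↑ 1` with
  `sup_k ‖v(·,t_k)‖_{L^{3,∞}(Ω_{x*,R})} ≤ M`, and if `dist_{L^{3,∞}}(v(· + x*,1), 𝕃) ≤ ε`, then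
  `z* = (x*,1)` is a regular point of `v`. Here `𝕃` is the space of `f ∈ L^{3,∞}` with
  `‖f‖_{L^{3,∞}(B(r))} → 0` as `r → 0⁺` (equivalently the `L^{3,∞}` closure of the functions
  smooth near the origin).
* **Remark 3.4** (the interior case). If `x* ∈ Ω` no flattening of the boundary is needed: the
  same a priori estimates hold and the rescaled solutions converge to a suitable weak solution on
  `ℝ³ × ]1/2,1[`, small in `L^{3,∞}` at time `1`, singular at the origin — contradicting the
  Liouville-type Lemma 3.3.

## What is recorded (interior case, unit ball, terminal slice in `𝕃`)

The named fact `albrittonBarker2020_localWeakL3_regularity` is Theorem 3.1 with Remark 3.4 in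
the following SPECIAL CASE, stated in the tree's vocabulary:
* `Ω = B(x*,1)` (a bounded `C^∞` domain), `Γ = ∅`, `I = ]0,1[` as printed, so that
  `Ω × ]0,1[ = Q(z*,1)`, `z* = (1,x*)` (`parabolicCylinder 1 (1,x*)`, time first), and
  `0 < R < 1` (`⇔ Ω̄_{x*,R} = B̄(x*,R) ⊂ Ω`);
* the class of Def. 2.1 (with `Γ = ∅`: an interior suitable weak solution) is the tree class
  `IsSuitableWeakSolutionInBall 1 (1,x*) v q` (`LocalTypeI.lean`, Albritton–Barker 2019 Def. 2.1:
  the accepted local notion `IsSuitableWeakSolutionOn` on the open cylinder — distributional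
  equations, space–time integrated local energy inequality — plus `v ∈ L_{2,∞}`, `∇v ∈ L₂`
  through a weak spatial gradient, `q ∈ L_{3/2}` on the WHOLE cylinder; Def. 2.1 here asks these
  only on `Ω' × ]S',1[`, `Ω' ⋐ Ω`, `S' > 0` — the global class is a special case; the a.e.-`t`
  slice form of the energy inequality for cut-offs not vanishing at `t = 1` follows from the
  integrated one at Lebesgue points, as recorded in the docstring of `IsSuitableWeakSolutionInBall`);
* `v ∈ L_∞(Ω × ]0,t[)` for all `0 < t < 1` verbatim;
* the slices `v(·,t)`, `t ∈ ]0,1]`, are those of the weakly continuous representative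
  (footnote to Def. 2.1): `t ↦ ∫⟪v(t),w⟫` is continuous on `]0,1]` for every `w ∈ L²`
  supported in `Ω` — this pins down `v(·,t_k)` and `v(·,1)`;
* `t_k ↑ 1`: a strictly increasing sequence in `]0,1[` converging to `1`, and
  `‖v(·,t_k)‖_{L^{3,∞}(B(x*,R))} ≤ M` for all `k` in distribution form
  `α³ |{x ∈ B(x*,R) : α < |v(t_k,x)|}| ≤ M³` (`α > 0`);
* TERMINAL SLICE: the case `dist_{L^{3,∞}}(v(· + x*,1), 𝕃) = 0`, i.e. `v(·,1) ∈ 𝕃` (after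
  extension by zero off `Ω`): `v(·,1) ∈ L^{3,∞}(Ω)` and `‖v(·,1)‖_{L^{3,∞}(B(x*,r))} → 0` as
  `r ↓ 0`, both in distribution form. Then the smallness hypothesis `dist ≤ ε(Ω,M)` holds for
  every `M`, so `ε` does not appear (e.g. `v(·,1) ∈ L³(Ω)` suffices: Chebyshev and absolute
  continuity of the integral);
* CONCLUSION: "`z* = (x*,1)` is a regular point of `v`": `v` is essentially bounded on some
  `Q(z*,r)`, `r > 0`, recorded as `¬ IsBackwardSingularPoint v (1,x*)` (`LocalTypeI.lean`; the
  cylinders `Q(z*,r) = ]1 − r², 1[ × B(x*,r)`, `r ≤ 1`, lie in `Ω × ]0,1[`; in the proof, c13: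
  "`v^∞` is essentially bounded in `ℝ³₊ × ]3/4,1[`. This contradicts [singularity]").
-- TODO(general form): `ε`-closeness `dist_{L^{3,∞}}(v(·+x*,1), 𝕃) ≤ ε(Ω,M)` instead of
-- membership; a general bounded `C²` domain `Ω` with the local class on `Ω' ⋐ Ω`; the boundary
-- case `x* ∈ Γ` (needs boundary suitable weak solutions / `C²` domains in the tree).

Also in this file, PROVED from the fact by the Navier–Stokes scaling (CKN 1982 §2; ESŠ 2003 §3):
* `albrittonBarker2020_localWeakL3_regularity.of_suitableWeakOn_viscosity` — the consumption
  shape at viscosity `ν > 0` on a parabolic ball `Q(z₀,R)` (class `IsSuitableWeakSolutionOn` at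
  viscosity `ν` + the global clauses spelled out, `∇v ∈ L²` as `cknE R z₀ G < ⊤`, weak-`L³`
  bound `M` along `s_k ↑ t₀`, terminal slice `v(t₀) ∈ L³(B(x₀,R))`, conclusion
  `∃ r > 0, v ∈ L_∞(Q(z₀,r))`). Mechanism: with `θ = min(1,√ν)`, `R' = θR`, `β = R'²/ν ≤ R²`,
  the affine map `Φ(s,y) = (t₀ − β + βs, x₀ + R'y)` takes `Q((1,0),1) = ]0,1[ × B(0,1)` onto
  `]t₀ − β, t₀[ × B(x₀,R') ⊆ Q(z₀,R)`, and `v' = (R'/ν)·v∘Φ`, `q' = (R'/ν)²·q∘Φ` is a suitable weak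
  solution with viscosity `1` there (`IsSuitableWeakSolutionOn.stRescale`), in the class
  `IsSuitableWeakSolutionInBall 1 (1,0)`, bounded below the top, with weakly continuous slices,
  weak-`L³` bound `M/ν` along the tail of the transported sequence, terminal slice
  `(R'/ν)v(t₀, x₀ + R'·) ∈ L³(B(0,1)) ⊂ 𝕃`; regularity of `v'` at `(1,0)` on `Q((1,0),ρ)` is
  boundedness of `v` on `]t₀ − βρ², t₀[ × B(x₀,R'ρ) ⊇ Q(z₀, ρ·min(R',√β))`.
* Not transcribed: Theorem 1.1 (c3: interior/boundary `L³` blow-up `lim_{t↑T*} ‖v(t)‖_{L³(Ω_{x*,R})} = ∞`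
  at a singular point — no consumer yet), Theorem 1.3 (mild bounded ancient solutions as blow-up
  limits), the boundary statements, the truncation Proposition 2.2.

## Mathlib / tree search

`rg '1811.00507|AlbrittonBarker2020|jde.2020.06.009' lean/Literature` = asides only, no
transcription (2026-08-28; also nsreg-lit §R141). Reused: `IsSuitableWeakSolutionInBall`,
`IsBackwardSingularPoint` (`LocalTypeI.lean`), `IsSuitableWeakSolutionOn`, `cknE`,
`parabolicCylinder(Opens)`, `HasWeakSpatialGradientOn` (`SuitableWeak.lean`), the rescaling API
(`SpaceTimeRescaling.lean`, `SuitableWeakRescaling.lean`). Nearest prior decls: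
`seregin2019_localWeakL3_epsRegularity` (Seregin 2019 Prop. 1.4: `L_∞(L^{3,∞})` over the whole
time interval + sparse top slice; here: weak-`L³` along a SEQUENCE of times + terminal slice in
`𝕃`), `seregin_L3_blowup` / `AlbrittonBarkerForwardHolds` (global versions) — not implied.

## References

* D. Albritton, T. Barker, J. Differential Equations 269 (2020) 7529–7573 = arXiv:1811.00507,
  Def. 2.1, Thm. 3.1, Rmks. 3.2 and 3.4. [`AlbrittonBarker2020`]
* D. Albritton, T. Barker, Arch. Ration. Mech. Anal. (2019) = arXiv:1811.00502, Def. 2.1 (the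
  class `IsSuitableWeakSolutionInBall`). [`AlbrittonBarker2019`]
* L. Caffarelli, R. Kohn, L. Nirenberg, Comm. Pure Appl. Math. 35 (1982), §2 (suitable weak
  solutions; scaling). [`CaffarelliKohnNirenberg1982`]
-/

noncomputable section

open MeasureTheory Set Function Metric Filter
open _root_.Topology
open scoped ENNReal NNReal InnerProductSpace RealInnerProductSpace

namespace Literature.Analysis.FluidPDE

/-- **Albritton–Barker 2020, Theorem 3.1 in the interior case (Remark 3.4); unit ball, terminal
slice in `𝕃`.** For every centre `x*`, every `0 < R < 1` and every `M > 0`: let `(v,q)` be a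
suitable weak solution of the unforced Navier–Stokes equations (`ν = 1`) in
`Ω × ]0,1[ = Q((1,x*),1)`, `Ω = B(x*,1)` (Def. 2.1 with `Γ = ∅`, class
`IsSuitableWeakSolutionInBall 1 (1,x*) v q`), with `v ∈ L_∞(Ω × ]0,t[)` for all `0 < t < 1`,
whose slices `v(·,t)`, `t ∈ ]0,1]`, are the weakly-`L²(Ω)`-continuous representative; suppose
there is a sequence `t_k ↑ 1` with `sup_k ‖v(·,t_k)‖_{L^{3,∞}(B(x*,R))} ≤ M` (recorded:
`α³|{x ∈ B(x*,R) : α < |v(t_k,x)|}| ≤ M³` for all `α > 0`, `k`), and suppose the terminal slice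
lies in `𝕃`, `dist_{L^{3,∞}}(v(· + x*,1), 𝕃) = 0 ≤ ε(Ω,M)`: `v(·,1) ∈ L^{3,∞}(Ω)` and
`‖v(·,1)‖_{L^{3,∞}(B(x*,r))} → 0` as `r ↓ 0`. Then `z* = (x*,1)` is a regular point of `v`:
`v` is essentially bounded on `Q(z*,r)` for some `r > 0` (`¬ IsBackwardSingularPoint`).
See the module docstring for the printed general form (`ε`-closeness to `𝕃`, bounded `C²`
domains, boundary points `x* ∈ Γ`).
[cite: AlbrittonBarker2020, Thm. 3.1 + Rmk. 3.4 (arXiv:1811.00507 §3; J. Differential Equations 269 (2020) 7529–7573), Def. 2.1] -/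
def albrittonBarker2020_localWeakL3_regularity : Prop :=
  ∀ (xs : EuclideanSpace ℝ (Fin 3)) (R M : ℝ), 0 < R → R < 1 → 0 < M →
    ∀ (v : ℝ → EuclideanSpace ℝ (Fin 3) → EuclideanSpace ℝ (Fin 3))
      (q : ℝ → EuclideanSpace ℝ (Fin 3) → ℝ),
      -- Def. 2.1 (`Γ = ∅`) in `Ω × ]0,1[ = Q((1,x*),1)`, `Ω = B(x*,1)`
      IsSuitableWeakSolutionInBall 1 ((1 : ℝ), xs) v q →
      -- `v ∈ L_∞(Ω × ]0,t[)` for all `0 < t < 1`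
      (∀ t ∈ Ioo (0 : ℝ) 1,
        eLpNorm (uncurry v) ∞ (volume.restrict (Ioo (0 : ℝ) t ×ˢ ball xs 1)) < ∞) →
      -- the slices on `]0,1]` are the weakly-`L²(Ω)`-continuous representative
      (∀ w : EuclideanSpace ℝ (Fin 3) → EuclideanSpace ℝ (Fin 3), MemLp w 2 volume →
        Function.support w ⊆ ball xs 1 →
        ContinuousOn (fun t => ∫ x, ⟪v t x, w x⟫) (Ioc (0 : ℝ) 1)) →
      -- `t_k ↑ 1` with `sup_k ‖v(·,t_k)‖_{L^{3,∞}(B(x*,R))} ≤ M`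
      (∃ s : ℕ → ℝ, StrictMono s ∧ (∀ k, s k ∈ Ioo (0 : ℝ) 1) ∧ Tendsto s atTop (𝓝 1) ∧
        ∀ (k : ℕ) (α : ℝ), 0 < α →
          ENNReal.ofReal (α ^ 3) *
              (volume.restrict (ball xs R)) {x : EuclideanSpace ℝ (Fin 3) | α < ‖v (s k) x‖} ≤
            ENNReal.ofReal (M ^ 3)) →
      -- terminal slice in `𝕃`: `v(·,1) ∈ L^{3,∞}(Ω)` …
      (∃ A : ℝ, ∀ α : ℝ, 0 < α →
          ENNReal.ofReal (α ^ 3) *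
              (volume.restrict (ball xs 1)) {x : EuclideanSpace ℝ (Fin 3) | α < ‖v 1 x‖} ≤
            ENNReal.ofReal A) →
      -- … and `‖v(·,1)‖_{L^{3,∞}(B(x*,r))} → 0` as `r ↓ 0`
      (∀ δ : ℝ, 0 < δ → ∃ r : ℝ, 0 < r ∧ ∀ α : ℝ, 0 < α →
          ENNReal.ofReal (α ^ 3) *
              (volume.restrict (ball xs r)) {x : EuclideanSpace ℝ (Fin 3) | α < ‖v 1 x‖} ≤
            ENNReal.ofReal (δ ^ 3)) →
      -- `z* = (x*,1)` is a regular point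
      ¬ IsBackwardSingularPoint v ((1 : ℝ), xs)

section ScalingTools

/-- Volume of preimages under the space dilation `y ↦ x₀ + γy` of `ℝ³`, for an ARBITRARY set (the
measurable case is `volume_preimage_space_affine`). [folklore] -/
private theorem volume_preimage_dilate {γ : ℝ} (hγ : 0 < γ)
    (x₀ : EuclideanSpace ℝ (Fin 3)) (B : Set (EuclideanSpace ℝ (Fin 3))) :
    volume ((fun y : EuclideanSpace ℝ (Fin 3) => x₀ + γ • y) ⁻¹' B) =
      ENNReal.ofReal (γ ^ 3)⁻¹ * volume B := by
  have hme := (spaceAffineHomeomorph hγ.ne' x₀).measurableEmbedding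
  have h := hme.map_apply (volume : Measure (EuclideanSpace ℝ (Fin 3))) B
  rw [coe_spaceAffineHomeomorph] at h
  rw [← h, map_space_affine_volume hγ x₀, Measure.smul_apply, smul_eq_mul,
    finrank_euclideanSpace_fin]

/-- Superlevel sets of a dilated slice inside a ball: for `α, γ > 0`,
`|{y ∈ B(0,ρ) : a < ‖α f(x₀ + γy)‖}| = γ⁻³ |{x ∈ B(x₀, γρ) : a/α < ‖f x‖}|`. [folklore] -/
private theorem restrict_ball_superlevel_dilate {α γ : ℝ} (hα : 0 < α) (hγ : 0 < γ)
    (x₀ : EuclideanSpace ℝ (Fin 3)) (f : EuclideanSpace ℝ (Fin 3) → EuclideanSpace ℝ (Fin 3))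
    (a ρ : ℝ) :
    (volume.restrict (ball (0 : EuclideanSpace ℝ (Fin 3)) ρ))
        {y : EuclideanSpace ℝ (Fin 3) | a < ‖α • f (x₀ + γ • y)‖} =
      ENNReal.ofReal (γ ^ 3)⁻¹ *
        (volume.restrict (ball x₀ (γ * ρ))) {x : EuclideanSpace ℝ (Fin 3) | a / α < ‖f x‖} := by
  rw [Measure.restrict_apply' measurableSet_ball, Measure.restrict_apply' measurableSet_ball]
  have hset : {y : EuclideanSpace ℝ (Fin 3) | a < ‖α • f (x₀ + γ • y)‖} ∩ ball 0 ρ =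
      (fun y : EuclideanSpace ℝ (Fin 3) => x₀ + γ • y) ⁻¹'
        ({x : EuclideanSpace ℝ (Fin 3) | a / α < ‖f x‖} ∩ ball x₀ (γ * ρ)) := by
    ext y
    constructor
    · rintro ⟨h1, h2⟩
      refine ⟨?_, ?_⟩
      · rw [mem_setOf_eq, norm_smul, Real.norm_eq_abs, abs_of_pos hα] at h1
        rw [mem_setOf_eq, div_lt_iff₀' hα]
        exact h1
      · rw [mem_ball_zero_iff] at h2
        rw [mem_ball, dist_eq_norm, add_sub_cancel_left, norm_smul, Real.norm_eq_abs, abs_of_pos hγ]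
        exact mul_lt_mul_of_pos_left h2 hγ
    · rintro ⟨h1, h2⟩
      refine ⟨?_, ?_⟩
      · rw [mem_setOf_eq, div_lt_iff₀' hα] at h1
        rw [mem_setOf_eq, norm_smul, Real.norm_eq_abs, abs_of_pos hα]
        exact h1
      · rw [mem_ball, dist_eq_norm, add_sub_cancel_left, norm_smul, Real.norm_eq_abs,
          abs_of_pos hγ] at h2
        rw [mem_ball_zero_iff]
        exact lt_of_mul_lt_mul_left h2 hγ.le
  rw [hset, volume_preimage_dilate hγ]

/-- Essential suprema under the space–time rescaling:
`ess sup_{Φ⁻¹(S)} ‖α u ∘ Φ‖ = |α| · ess sup_S ‖u‖`. [folklore] -/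
private theorem eLpNorm_top_smul_stPull_preimage {β γ : ℝ} (hβ : 0 < β) (hγ : 0 < γ) (t₀ : ℝ)
    (x₀ : EuclideanSpace ℝ (Fin 3)) (α : ℝ)
    (u : ℝ → EuclideanSpace ℝ (Fin 3) → EuclideanSpace ℝ (Fin 3))
    (S : Set (ℝ × EuclideanSpace ℝ (Fin 3))) :
    eLpNorm (uncurry (α • stPull β γ t₀ x₀ u)) ∞ (volume.restrict (stAffine β γ t₀ x₀ ⁻¹' S)) =
      ‖α‖ₑ * eLpNorm (uncurry u) ∞ (volume.restrict S) := by
  have h1 : uncurry (α • stPull β γ t₀ x₀ u) = α • (uncurry u ∘ stAffine β γ t₀ x₀) := by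
    funext z
    rfl
  rw [h1, eLpNorm_const_smul]
  congr 1
  rw [← (measurableEmbedding_stAffine hβ.ne' hγ.ne' t₀ x₀).eLpNorm_map_measure,
    map_stAffine_volume_restrict_preimage hβ hγ, eLpNorm_exponent_top, eLpNorm_exponent_top]
  have hk : ENNReal.ofReal (β * γ ^ Module.finrank ℝ (EuclideanSpace ℝ (Fin 3)))⁻¹ ≠ 0 :=
    (ENNReal.ofReal_pos.2 (by positivity)).ne'
  refine le_antisymm (eLpNormEssSup_mono_measure _ Measure.smul_absolutelyContinuous)
    (eLpNormEssSup_mono_measure _ fun s hs => ?_)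
  simp only [Measure.smul_apply, smul_eq_mul, mul_eq_zero] at hs
  exact hs.resolve_left hk

/-- Pairings of a dilated slice against a test field: for `γ > 0`,
`∫ ⟪α f(x₀ + γy), φ(y)⟫ dy = α γ⁻³ ∫ ⟪f x, φ(γ⁻¹(x − x₀))⟫ dx`. [folklore] -/
private theorem integral_inner_dilate {γ : ℝ} (hγ : 0 < γ) (α : ℝ)
    (x₀ : EuclideanSpace ℝ (Fin 3)) (f φ : EuclideanSpace ℝ (Fin 3) → EuclideanSpace ℝ (Fin 3)) :
    ∫ y, ⟪α • f (x₀ + γ • y), φ y⟫ =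
      α * (γ ^ 3)⁻¹ * ∫ x, ⟪f x, φ (γ⁻¹ • (x - x₀))⟫ := by
  have h1 : ∀ y : EuclideanSpace ℝ (Fin 3), ⟪α • f (x₀ + γ • y), φ y⟫ =
      α * ⟪f (x₀ + γ • y), φ (γ⁻¹ • ((x₀ + γ • y) - x₀))⟫ := by
    intro y
    rw [real_inner_smul_left, add_sub_cancel_left, smul_smul, inv_mul_cancel₀ hγ.ne', one_smul]
  simp_rw [h1]
  rw [integral_const_mul, integral_comp_space_affine hγ x₀
    (fun x => ⟪f x, φ (γ⁻¹ • (x - x₀))⟫), finrank_euclideanSpace_fin, smul_eq_mul, mul_assoc]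

/-- `L²` is invariant under affine changes of variable: `φ(γ⁻¹(· − x₀)) ∈ L²` for `φ ∈ L²`,
`γ > 0`. [folklore] -/
private theorem memLp_two_comp_dilate_symm {γ : ℝ} (hγ : 0 < γ) (x₀ : EuclideanSpace ℝ (Fin 3))
    {φ : EuclideanSpace ℝ (Fin 3) → EuclideanSpace ℝ (Fin 3)} (hφ : MemLp φ 2 volume) :
    MemLp (fun x => φ (γ⁻¹ • (x - x₀))) 2 volume := by
  have e : (fun x : EuclideanSpace ℝ (Fin 3) => γ⁻¹ • (x - x₀)) =
      fun x => (-(γ⁻¹ • x₀)) + γ⁻¹ • x := by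
    funext x
    rw [smul_sub]
    abel
  have hmap : Measure.map (fun x : EuclideanSpace ℝ (Fin 3) => γ⁻¹ • (x - x₀)) volume =
      ENNReal.ofReal ((γ⁻¹) ^ Module.finrank ℝ (EuclideanSpace ℝ (Fin 3)))⁻¹ • volume := by
    rw [e]
    exact map_space_affine_volume (inv_pos.2 hγ) _
  have h2 : MemLp φ 2 (Measure.map (fun x : EuclideanSpace ℝ (Fin 3) => γ⁻¹ • (x - x₀)) volume) := by
    rw [hmap]
    exact hφ.smul_measure ENNReal.ofReal_ne_top
  have hmeas : AEMeasurable (fun x : EuclideanSpace ℝ (Fin 3) => γ⁻¹ • (x - x₀)) volume :=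
    ((measurable_id.sub_const x₀).const_smul γ⁻¹).aemeasurable
  exact h2.comp_of_map hmeas

/-- Chebyshev in distribution form on a set: for `f ∈ L³(S)` and `b > 0`,
`b³ |{x ∈ S : b < ‖f x‖}| ≤ ∫_S ‖f‖³`. [folklore] -/
private theorem ofReal_pow_mul_restrict_superlevel_le_lintegral
    {f : EuclideanSpace ℝ (Fin 3) → EuclideanSpace ℝ (Fin 3)} {S : Set (EuclideanSpace ℝ (Fin 3))}
    (hf : AEStronglyMeasurable f (volume.restrict S)) {b : ℝ} (hb : 0 < b) :
    ENNReal.ofReal (b ^ 3) * (volume.restrict S) {x : EuclideanSpace ℝ (Fin 3) | b < ‖f x‖} ≤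
      ∫⁻ x in S, ‖f x‖ₑ ^ (3 : ℝ) := by
  have h3 : (3 : ℝ≥0∞) ≠ 0 := by norm_num
  have h3' : (3 : ℝ≥0∞) ≠ ⊤ := ENNReal.ofNat_ne_top
  have hcheb := mul_meas_ge_le_pow_eLpNorm' (μ := volume.restrict S) h3 h3' hf (ENNReal.ofReal b)
  rw [ENNReal.toReal_ofNat] at hcheb
  have hnorm : eLpNorm f 3 (volume.restrict S) ^ (3 : ℝ) = ∫⁻ x in S, ‖f x‖ₑ ^ (3 : ℝ) := by
    rw [eLpNorm_eq_lintegral_rpow_enorm_toReal h3 h3', ENNReal.toReal_ofNat, one_div,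
      ENNReal.rpow_inv_rpow (by norm_num)]
  rw [hnorm] at hcheb
  have hsub : {x : EuclideanSpace ℝ (Fin 3) | b < ‖f x‖} ⊆
      {x : EuclideanSpace ℝ (Fin 3) | ENNReal.ofReal b ≤ ‖f x‖ₑ} := by
    intro x hx
    rw [mem_setOf_eq] at hx ⊢
    rw [← ofReal_norm]
    exact ENNReal.ofReal_le_ofReal hx.le
  have hpow : ENNReal.ofReal (b ^ 3) = ENNReal.ofReal b ^ (3 : ℝ) := by
    rw [ENNReal.ofReal_rpow_of_pos hb]
    norm_cast
  rw [hpow]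
  exact (mul_le_mul' le_rfl (measure_mono hsub)).trans hcheb

end ScalingTools

section Viscosity

/-- **Albritton–Barker 2020, Thm. 3.1 (interior) at viscosity `ν > 0`, terminal slice in `L³`**
(from the unit viscosity fact by the Navier–Stokes scaling; the consumption shape of the
«liminf fence»). For every parabolic ball `Q(z₀,R)`, `R > 0`, and every suitable weak solution
`(v,q)` of the unforced Navier–Stokes equations with viscosity `ν` on `Q(z₀,R)`
(`IsSuitableWeakSolutionOn`) with `v ∈ L_{2,∞}(Q(z₀,R))`, `q ∈ L_{3/2}(Q(z₀,R))`, a weak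
gradient `G` with `E(G,R;z₀) < ∞`, `v ∈ L_∞(]t₀ − R², t'[ × B(x₀,R))` for every `t' < t₀`, whose
slices on `]t₀ − R², t₀]` are the weakly-`L²(B(x₀,R))`-continuous representative: if along a
strictly increasing sequence `s_k → t₀` in `]t₀ − R², t₀[` the weak-`L³(B(x₀,R))` quasi-norms are
bounded, `α³|{x ∈ B(x₀,R) : α < |v(s_k,x)|}| ≤ M³` (`α > 0`), and `v(t₀) ∈ L³(B(x₀,R))`, then
`v ∈ L_∞(Q(z₀,r))` for some `r > 0`.
[cite: AlbrittonBarker2020, Thm. 3.1 + Rmk. 3.4 (arXiv:1811.00507 §3); CaffarelliKohnNirenberg1982, §2 (scaling)] -/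
theorem albrittonBarker2020_localWeakL3_regularity.of_suitableWeakOn_viscosity
    (h : albrittonBarker2020_localWeakL3_regularity) {ν : ℝ} (hν : 0 < ν) :
    ∀ (z₀ : ℝ × EuclideanSpace ℝ (Fin 3)) (R M : ℝ), 0 < R →
    ∀ (v : ℝ → EuclideanSpace ℝ (Fin 3) → EuclideanSpace ℝ (Fin 3))
      (q : ℝ → EuclideanSpace ℝ (Fin 3) → ℝ),
      IsSuitableWeakSolutionOn (parabolicCylinderOpens R z₀) ν 0 v q →
      (∃ C : ℝ≥0, ∀ᵐ t ∂(volume.restrict (Ioo (z₀.1 - R ^ 2) z₀.1)),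
        ∫⁻ x in ball z₀.2 R, ‖v t x‖ₑ ^ 2 ≤ C) →
      MemLp (uncurry q) (3 / 2) (volume.restrict (parabolicCylinder R z₀)) →
      ∀ G : ℝ → EuclideanSpace ℝ (Fin 3) → EuclideanSpace ℝ (Fin 3) →L[ℝ] EuclideanSpace ℝ (Fin 3),
        HasWeakSpatialGradientOn (parabolicCylinderOpens R z₀) v G →
        cknE R z₀ G < ⊤ →
        (∀ t' ∈ Ioo (z₀.1 - R ^ 2) z₀.1, eLpNorm (uncurry v) ⊤
          (volume.restrict (Ioo (z₀.1 - R ^ 2) t' ×ˢ ball z₀.2 R)) < ⊤) →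
        (∀ w : EuclideanSpace ℝ (Fin 3) → EuclideanSpace ℝ (Fin 3), MemLp w 2 volume →
          Function.support w ⊆ ball z₀.2 R →
          ContinuousOn (fun t => ∫ x, ⟪v t x, w x⟫_ℝ) (Ioc (z₀.1 - R ^ 2) z₀.1)) →
        (∃ s : ℕ → ℝ, StrictMono s ∧ (∀ k, s k ∈ Ioo (z₀.1 - R ^ 2) z₀.1) ∧
          Tendsto s atTop (𝓝 z₀.1) ∧
          ∀ (k : ℕ) (α : ℝ), 0 < α →
            ENNReal.ofReal (α ^ 3) *
                volume.restrict (ball z₀.2 R) {x : EuclideanSpace ℝ (Fin 3) | α < ‖v (s k) x‖} ≤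
              ENNReal.ofReal (M ^ 3)) →
        MemLp (v z₀.1) 3 (volume.restrict (ball z₀.2 R)) →
        ∃ r : ℝ, 0 < r ∧ eLpNorm (uncurry v) ⊤ (volume.restrict (parabolicCylinder r z₀)) < ⊤ := by
  intro z₀ R M hR v q hsw hC hq G hG hE hbdd hwc hseq hL3
  -- the scale factor `θ = min(1, √ν)`, `R' = θR`, `β = R'²/ν ≤ R²`, `α = R'/ν`, base time `tb = t₀ − β`
  obtain ⟨θ, hθdef⟩ : ∃ θ : ℝ, θ = min 1 (Real.sqrt ν) := ⟨_, rfl⟩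
  have hsν : 0 < Real.sqrt ν := Real.sqrt_pos.2 hν
  have hθpos : 0 < θ := by rw [hθdef]; exact lt_min one_pos hsν
  have hθ1 : θ ≤ 1 := by rw [hθdef]; exact min_le_left _ _
  have hθs : θ ≤ Real.sqrt ν := by rw [hθdef]; exact min_le_right _ _
  have hθ2 : θ ^ 2 ≤ ν := by
    calc θ ^ 2 ≤ Real.sqrt ν ^ 2 := pow_le_pow_left₀ hθpos.le hθs 2
      _ = ν := Real.sq_sqrt hν.le
  obtain ⟨R', hR'def⟩ : ∃ R' : ℝ, R' = θ * R := ⟨_, rfl⟩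
  have hR' : 0 < R' := by rw [hR'def]; exact mul_pos hθpos hR
  have hR'R : R' ≤ R := by rw [hR'def]; exact mul_le_of_le_one_left hR.le hθ1
  obtain ⟨β, hβdef⟩ : ∃ β : ℝ, β = R' ^ 2 / ν := ⟨_, rfl⟩
  have hβ : 0 < β := by rw [hβdef]; positivity
  have hβR : β ≤ R ^ 2 := by
    rw [hβdef, div_le_iff₀ hν, hR'def, mul_pow]
    calc θ ^ 2 * R ^ 2 ≤ ν * R ^ 2 := by gcongr
      _ = R ^ 2 * ν := mul_comm _ _
  obtain ⟨α, hαdef⟩ : ∃ α : ℝ, α = R' / ν := ⟨_, rfl⟩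
  have hα : 0 < α := by rw [hαdef]; positivity
  have hβeq : β = α * R' := by rw [hβdef, hαdef]; ring
  obtain ⟨tb, htbdef⟩ : ∃ tb : ℝ, tb = z₀.1 - β := ⟨_, rfl⟩
  -- the `ν`-cylinder `PO = ]t₀ − β, t₀[ × B(x₀, R')` inside `Q(z₀, R)`; its preimage is `Q((1,0),1)`
  set z₁ : ℝ × EuclideanSpace ℝ (Fin 3) := ((1 : ℝ), (0 : EuclideanSpace ℝ (Fin 3))) with hz₁
  set POs : Set (ℝ × EuclideanSpace ℝ (Fin 3)) := Ioo (z₀.1 - β) z₀.1 ×ˢ ball z₀.2 R'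
    with hPOs
  have hPOsub : POs ⊆ parabolicCylinder R z₀ := by
    rw [hPOs, parabolicCylinder]
    exact prod_mono (Ioo_subset_Ioo (by linarith) le_rfl) (ball_subset_ball hR'R)
  set PO : TopologicalSpace.Opens (ℝ × EuclideanSpace ℝ (Fin 3)) :=
    ⟨POs, isOpen_Ioo.prod isOpen_ball⟩ with hPO
  have hPOle : PO ≤ parabolicCylinderOpens R z₀ := fun z hz => hPOsub hz
  -- preimages of the cylinders `]t₀ − β, tb + βb[ × B(x₀, R'ρ)` under `Φ`
  have hpre : ∀ b ρ : ℝ, stAffine β R' tb z₀.2 ⁻¹' (Ioo (z₀.1 - β) (tb + β * b) ×ˢ ball z₀.2 (R' * ρ)) =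
      Ioo (0 : ℝ) b ×ˢ ball (0 : EuclideanSpace ℝ (Fin 3)) ρ := by
    intro b ρ
    rw [stAffine_preimage_cylinder hβ hR' tb z₀.2 z₀.2]
    have e1 : (z₀.1 - β - tb) / β = 0 := by rw [htbdef, sub_self, zero_div]
    have e2 : (tb + β * b - tb) / β = b := by
      rw [add_sub_cancel_left, mul_div_cancel_left₀ b hβ.ne']
    have e3 : R'⁻¹ • (z₀.2 - z₀.2) = (0 : EuclideanSpace ℝ (Fin 3)) := by rw [sub_self, smul_zero]
    have e4 : R' * ρ / R' = ρ := mul_div_cancel_left₀ ρ hR'.ne'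
    rw [e1, e2, e3, e4]
  have htb1 : tb + β * 1 = z₀.1 := by rw [htbdef]; ring
  have hpre1' : stAffine β R' tb z₀.2 ⁻¹' POs = parabolicCylinder 1 z₁ := by
    have h1 := hpre 1 1
    rw [htb1, mul_one] at h1
    rw [hPOs, h1, hz₁, parabolicCylinder]
    norm_num
  have hpre1 : stPreimage β R' tb z₀.2 PO = parabolicCylinderOpens 1 z₁ := by
    apply TopologicalSpace.Opens.ext
    rw [coe_stPreimage]
    exact hpre1'
  -- the rescaled pair and gradient
  set v' : ℝ → EuclideanSpace ℝ (Fin 3) → EuclideanSpace ℝ (Fin 3) := α • stPull β R' tb z₀.2 v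
    with hv'
  set q' : ℝ → EuclideanSpace ℝ (Fin 3) → ℝ := α ^ 2 • stPull β R' tb z₀.2 q with hq'
  set G' : ℝ → EuclideanSpace ℝ (Fin 3) → EuclideanSpace ℝ (Fin 3) →L[ℝ] EuclideanSpace ℝ (Fin 3) :=
    (α * R') • stPull β R' tb z₀.2 G with hG'
  have hv'ap : ∀ s y, v' s y = α • v (tb + β * s) (z₀.2 + R' • y) := by
    intro s y; rw [hv', smul_stPull_apply]
  -- (1) suitable weak at unit viscosity on `Q((1,0),1)`
  have hsuit1 : IsSuitableWeakSolutionOn (parabolicCylinderOpens 1 z₁) 1 0 v' q' := by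
    have h0 := (hsw.of_le hPOle).stRescale hα hR' hβeq tb z₀.2
    have hvisc : α * ν / R' = 1 := by
      rw [hαdef]; field_simp
    have hforce : ((α ^ 2 * R') • stPull β R' tb z₀.2
        (0 : ℝ → EuclideanSpace ℝ (Fin 3) → EuclideanSpace ℝ (Fin 3))) = 0 := by
      funext s y; simp [stPull]
    rw [hvisc, hforce, hpre1] at h0
    exact h0
  -- (2) the energy class on `Q((1,0),1)`
  have hC1 : ∃ C₁ : ℝ≥0, ∀ᵐ s ∂(volume.restrict (Ioo (z₁.1 - 1 ^ 2) z₁.1)),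
      ∫⁻ y in ball z₁.2 1, ‖v' s y‖ₑ ^ 2 ≤ C₁ := by
    obtain ⟨C, hC⟩ := hC
    have hC0 : ∀ᵐ t ∂(volume.restrict (Ioo (tb + β * 0) (tb + β * 1))),
        ∫⁻ x in ball z₀.2 R', ‖v t x‖ₑ ^ 2 ≤ (C : ℝ≥0∞) := by
      have e : Ioo (tb + β * 0) (tb + β * 1) = Ioo (z₀.1 - β) z₀.1 := by
        rw [htbdef]; congr 1 <;> ring
      rw [e]
      have hsubI : Ioo (z₀.1 - β) z₀.1 ⊆ Ioo (z₀.1 - R ^ 2) z₀.1 :=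
        Ioo_subset_Ioo (by linarith) le_rfl
      filter_upwards [ae_restrict_of_ae_restrict_of_subset hsubI hC] with t ht
      exact (lintegral_mono_set (ball_subset_ball hR'R)).trans ht
    have h2 := ae_sliced_setLIntegral_ball_stRescale hβ hR' tb z₀.2 z₀.2 R' 0 1
      (fun t x => ‖v t x‖ₑ ^ 2) hC0
    rw [finrank_euclideanSpace_fin, sub_self, smul_zero, div_self hR'.ne'] at h2
    set C₁ : ℝ≥0∞ := ‖α‖ₑ ^ 2 * (ENNReal.ofReal (R' ^ 3)⁻¹ * C) with hC₁
    have hC₁top : C₁ ≠ ⊤ :=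
      ENNReal.mul_ne_top (by simp) (ENNReal.mul_ne_top ENNReal.ofReal_ne_top ENNReal.coe_ne_top)
    refine ⟨C₁.toNNReal, ?_⟩
    rw [ENNReal.coe_toNNReal hC₁top]
    have hset : Ioo (z₁.1 - 1 ^ 2) z₁.1 = Ioo (0 : ℝ) 1 := by rw [hz₁]; norm_num
    rw [hset]
    filter_upwards [h2] with s hs
    have e : ∀ y : EuclideanSpace ℝ (Fin 3), ‖v' s y‖ₑ ^ 2 =
        ‖α‖ₑ ^ 2 * ‖v (tb + β * s) (z₀.2 + R' • y)‖ₑ ^ 2 := by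
      intro y
      rw [hv'ap, enorm_smul, mul_pow]
    simp only [e]
    rw [lintegral_const_mul' _ _ (by simp)]
    refine mul_le_mul' le_rfl ?_
    have e0 : z₁.2 = 0 := rfl
    rw [e0]
    exact hs
  -- (3) the weak gradient on `Q((1,0),1)` and its square integrability
  have hGv : HasWeakSpatialGradientOn (parabolicCylinderOpens 1 z₁) v' G' := by
    rw [← hpre1]
    exact (hG.mono hPOle).stRescale α hβ hR' tb z₀.2
  have hEfin : ∫⁻ w in parabolicCylinder R z₀, ENNReal.ofReal (frobeniusNormSq (G w.1 w.2)) < ⊤ := by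
    have hR0 : (ENNReal.ofReal R)⁻¹ ≠ 0 := ENNReal.inv_ne_zero.2 ENNReal.ofReal_ne_top
    unfold cknE at hE
    rcases ENNReal.mul_lt_top_iff.1 hE with h2 | h0 | h0
    · exact h2.2
    · exact absurd h0 hR0
    · rw [h0]; exact ENNReal.zero_lt_top
  have hGv2 : ∫⁻ w in parabolicCylinder 1 z₁,
      ENNReal.ofReal (frobeniusNormSq (G' w.1 w.2)) < ⊤ := by
    rw [← hpre1', hG', setLIntegral_frobeniusNormSq_stRescale hβ hR' tb z₀.2 (α * R') G POs]
    exact ENNReal.mul_lt_top (ENNReal.mul_lt_top ENNReal.ofReal_lt_top ENNReal.ofReal_lt_top)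
      ((lintegral_mono_set hPOsub).trans_lt hEfin)
  -- (4) the pressure class on `Q((1,0),1)`
  have h32 : ((3 : ℝ≥0∞) / 2).toReal = 3 / 2 := by
    rw [ENNReal.toReal_div]; norm_num
  have h32top : (3 : ℝ≥0∞) / 2 ≠ ⊤ := (ENNReal.div_lt_top (by simp) (by simp)).ne
  have hqfin : ∫⁻ w in parabolicCylinder R z₀, ‖q w.1 w.2‖ₑ ^ (3 / 2 : ℝ) < ⊤ := by
    have hq1 := hq.eLpNorm_lt_top
    rw [eLpNorm_eq_lintegral_rpow_enorm_toReal (by norm_num) h32top, h32] at hq1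
    exact (ENNReal.rpow_lt_top_iff_of_pos (by norm_num : (0 : ℝ) < 1 / (3 / 2))).1 hq1
  have hq32 : MemLp (uncurry q') (3 / 2) (volume.restrict (parabolicCylinder 1 z₁)) := by
    refine ⟨hsuit1.distributional.2.2.1.aestronglyMeasurable, ?_⟩
    rw [eLpNorm_eq_lintegral_rpow_enorm_toReal (by norm_num) h32top, h32]
    refine ENNReal.rpow_lt_top_of_nonneg (by positivity) (ne_of_lt ?_)
    show ∫⁻ w in parabolicCylinder 1 z₁,
        ‖(α ^ 2 • stPull β R' tb z₀.2 q) w.1 w.2‖ₑ ^ (3 / 2 : ℝ) < ⊤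
    rw [← hpre1', setLIntegral_enorm_rpow_stRescale hβ hR' tb z₀.2 (α ^ 2) q POs (by norm_num)]
    refine ENNReal.mul_lt_top (ENNReal.mul_lt_top
      (ENNReal.rpow_lt_top_of_nonneg (by norm_num) enorm_ne_top) ENNReal.ofReal_lt_top) ?_
    exact (lintegral_mono_set hPOsub).trans_lt hqfin
  have hball : IsSuitableWeakSolutionInBall 1 z₁ v' q' := ⟨hsuit1, hC1, ⟨G', hGv, hGv2⟩, hq32⟩
  -- (5) `v' ∈ L_∞(]0,t[ × B(0,1))` for `0 < t < 1`
  have hbdd' : ∀ t ∈ Ioo (0 : ℝ) 1,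
      eLpNorm (uncurry v') ∞ (volume.restrict (Ioo (0 : ℝ) t ×ˢ ball z₁.2 1)) < ∞ := by
    intro t ht
    have e0 : z₁.2 = 0 := rfl
    rw [e0, ← hpre t 1, mul_one, hv', eLpNorm_top_smul_stPull_preimage hβ hR' tb z₀.2 α v]
    refine ENNReal.mul_lt_top enorm_lt_top ?_
    have ht' : tb + β * t ∈ Ioo (z₀.1 - R ^ 2) z₀.1 := by
      rw [htbdef]
      constructor <;> nlinarith [ht.1, ht.2]
    have hsub : Ioo (z₀.1 - β) (tb + β * t) ×ˢ ball z₀.2 R' ⊆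
        Ioo (z₀.1 - R ^ 2) (tb + β * t) ×ˢ ball z₀.2 R :=
      prod_mono (Ioo_subset_Ioo (by linarith) le_rfl) (ball_subset_ball hR'R)
    exact (eLpNorm_mono_measure (uncurry v) (Measure.restrict_mono hsub le_rfl)).trans_lt
      (hbdd _ ht')
  -- (6) weak continuity of the slices of `v'` on `]0,1]` in `L²(B(0,1))`
  have hwc' : ∀ φ : EuclideanSpace ℝ (Fin 3) → EuclideanSpace ℝ (Fin 3), MemLp φ 2 volume →
      Function.support φ ⊆ ball z₁.2 1 →
      ContinuousOn (fun s => ∫ y, ⟪v' s y, φ y⟫) (Ioc (0 : ℝ) 1) := by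
    intro φ hφ hφs
    set w : EuclideanSpace ℝ (Fin 3) → EuclideanSpace ℝ (Fin 3) :=
      fun x => φ (R'⁻¹ • (x - z₀.2)) with hwdef
    have hwL2 : MemLp w 2 volume := memLp_two_comp_dilate_symm hR' z₀.2 hφ
    have hws : Function.support w ⊆ ball z₀.2 R := by
      intro x hx
      have hx' : R'⁻¹ • (x - z₀.2) ∈ ball (0 : EuclideanSpace ℝ (Fin 3)) 1 := hφs hx
      rw [mem_ball, dist_zero_right, norm_smul, Real.norm_eq_abs, abs_of_pos (inv_pos.2 hR'),
        inv_mul_lt_iff₀ hR', mul_one] at hx'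
      rw [mem_ball, dist_eq_norm]
      exact lt_of_lt_of_le hx' hR'R
    have key : ∀ s : ℝ, ∫ y, ⟪v' s y, φ y⟫ =
        α * (R' ^ 3)⁻¹ * ∫ x, ⟪v (tb + β * s) x, w x⟫ := by
      intro s
      have e : (fun y => ⟪v' s y, φ y⟫) =
          fun y => ⟪α • v (tb + β * s) (z₀.2 + R' • y), φ y⟫ := by
        funext y; rw [hv'ap]
      rw [e]
      exact integral_inner_dilate hR' α z₀.2 (v (tb + β * s)) φ
    have hcont := hwc w hwL2 hws
    have hmaps : MapsTo (fun s : ℝ => tb + β * s) (Ioc (0 : ℝ) 1) (Ioc (z₀.1 - R ^ 2) z₀.1) := by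
      intro s hs
      rw [htbdef]
      constructor <;> nlinarith [hs.1, hs.2]
    have haff : ContinuousOn (fun s : ℝ => tb + β * s) (Ioc (0 : ℝ) 1) :=
      (by fun_prop : Continuous fun s : ℝ => tb + β * s).continuousOn
    have hcomp := (hcont.comp haff hmaps).const_smul (α * (R' ^ 3)⁻¹)
    rw [show (fun s => ∫ y, ⟪v' s y, φ y⟫) =
      fun s => α * (R' ^ 3)⁻¹ * ∫ x, ⟪v (tb + β * s) x, w x⟫ from funext key]
    exact hcomp
  -- (7) the tail of the transported sequence and the weak-`L³` bound `M/ν` on `B(0,1/2)`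
  obtain ⟨s, hsmono, hsI, hstend, hsM⟩ := hseq
  obtain ⟨K, hK⟩ : ∃ K : ℕ, ∀ k ≥ K, z₀.1 - β < s k :=
    eventually_atTop.1 (hstend.eventually (lt_mem_nhds (by linarith)))
  set s' : ℕ → ℝ := fun k => (s (k + K) - tb) / β with hs'
  have hs'eq : ∀ k, tb + β * s' k = s (k + K) := by
    intro k
    rw [hs', mul_div_cancel₀ _ hβ.ne']
    ring
  set M' : ℝ := |M| / ν + 1 with hM'
  have hM'pos : 0 < M' := by rw [hM']; positivity
  have hMM' : ENNReal.ofReal ((M / ν) ^ 3) ≤ ENNReal.ofReal (M' ^ 3) := by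
    apply ENNReal.ofReal_le_ofReal
    calc (M / ν) ^ 3 ≤ |(M / ν) ^ 3| := le_abs_self _
      _ = |M / ν| ^ 3 := (pow_abs _ _).symm
      _ ≤ M' ^ 3 := by
          apply pow_le_pow_left₀ (abs_nonneg _)
          rw [hM', abs_div, abs_of_pos hν]
          linarith
  have hseq' : ∃ s' : ℕ → ℝ, StrictMono s' ∧ (∀ k, s' k ∈ Ioo (0 : ℝ) 1) ∧
      Tendsto s' atTop (𝓝 1) ∧
      ∀ (k : ℕ) (a : ℝ), 0 < a →
        ENNReal.ofReal (a ^ 3) *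
            (volume.restrict (ball z₁.2 (1 / 2))) {y : EuclideanSpace ℝ (Fin 3) | a < ‖v' (s' k) y‖} ≤
          ENNReal.ofReal (M' ^ 3) := by
    refine ⟨s', ?_, ?_, ?_, ?_⟩
    · intro a b hab
      rw [hs']
      exact div_lt_div_of_pos_right (sub_lt_sub_right (hsmono (Nat.add_lt_add_right hab K)) _) hβ
    · intro k
      have h1 := hK (k + K) (Nat.le_add_left K k)
      have h2 := (hsI (k + K)).2
      rw [hs']
      constructor
      · apply div_pos _ hβ
        rw [htbdef]; linarith
      · rw [div_lt_one hβ, htbdef]; linarith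
    · have h1 : Tendsto (fun k => (s (k + K) - tb) / β) atTop (𝓝 ((z₀.1 - tb) / β)) :=
        (((hstend.comp (tendsto_add_atTop_nat K)).sub_const tb).div_const β)
      have e : (z₀.1 - tb) / β = 1 := by
        rw [htbdef, sub_sub_cancel, div_self hβ.ne']
      rw [e] at h1
      exact h1
    · intro k a ha
      have e0 : z₁.2 = 0 := rfl
      have hset : (volume.restrict (ball (0 : EuclideanSpace ℝ (Fin 3)) (1 / 2)))
            {y : EuclideanSpace ℝ (Fin 3) | a < ‖v' (s' k) y‖} =
          ENNReal.ofReal (R' ^ 3)⁻¹ *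
            (volume.restrict (ball z₀.2 (R' * (1 / 2))))
              {x : EuclideanSpace ℝ (Fin 3) | a / α < ‖v (s (k + K)) x‖} := by
        have h1 := restrict_ball_superlevel_dilate hα hR' z₀.2 (v (tb + β * s' k)) a (1 / 2)
        rw [hs'eq k] at h1
        rw [← h1]
        congr 1
        ext y
        rw [mem_setOf_eq, mem_setOf_eq, hv'ap, hs'eq k]
      have hmono : (volume.restrict (ball z₀.2 (R' * (1 / 2))))
            {x : EuclideanSpace ℝ (Fin 3) | a / α < ‖v (s (k + K)) x‖} ≤
          (volume.restrict (ball z₀.2 R))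
            {x : EuclideanSpace ℝ (Fin 3) | a / α < ‖v (s (k + K)) x‖} :=
        Measure.le_iff'.1 (Measure.restrict_mono (ball_subset_ball (by linarith)) le_rfl) _
      have hyp := hsM (k + K) (a / α) (div_pos ha hα)
      have ha3 : a ^ 3 = α ^ 3 * (a / α) ^ 3 := by
        field_simp
      rw [e0, hset, ha3, ENNReal.ofReal_mul (by positivity)]
      calc ENNReal.ofReal (α ^ 3) * ENNReal.ofReal ((a / α) ^ 3) * (ENNReal.ofReal (R' ^ 3)⁻¹ *
            (volume.restrict (ball z₀.2 (R' * (1 / 2))))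
              {x : EuclideanSpace ℝ (Fin 3) | a / α < ‖v (s (k + K)) x‖})
          = ENNReal.ofReal (α ^ 3) * ENNReal.ofReal (R' ^ 3)⁻¹ * (ENNReal.ofReal ((a / α) ^ 3) *
            (volume.restrict (ball z₀.2 (R' * (1 / 2))))
              {x : EuclideanSpace ℝ (Fin 3) | a / α < ‖v (s (k + K)) x‖}) := by ring
        _ ≤ ENNReal.ofReal (α ^ 3) * ENNReal.ofReal (R' ^ 3)⁻¹ * (ENNReal.ofReal ((a / α) ^ 3) *
            (volume.restrict (ball z₀.2 R))
              {x : EuclideanSpace ℝ (Fin 3) | a / α < ‖v (s (k + K)) x‖}) := by gcongr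
        _ ≤ ENNReal.ofReal (α ^ 3) * ENNReal.ofReal (R' ^ 3)⁻¹ * ENNReal.ofReal (M ^ 3) := by
            gcongr
        _ = ENNReal.ofReal ((M / ν) ^ 3) := by
            rw [← ENNReal.ofReal_mul (by positivity), ← ENNReal.ofReal_mul (by positivity)]
            congr 1
            rw [hαdef]
            field_simp
        _ ≤ ENNReal.ofReal (M' ^ 3) := hMM'
  -- (8) the terminal slice `v'(1) = α v(t₀, x₀ + R'·)`: weak-`L³` on `B(0,1)` and vanishing at `0`
  have hL3fin : ∫⁻ x in ball z₀.2 R, ‖v z₀.1 x‖ₑ ^ (3 : ℝ) < ⊤ := by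
    have h1 := hL3.eLpNorm_lt_top
    rw [eLpNorm_eq_lintegral_rpow_enorm_toReal (by norm_num) ENNReal.ofNat_ne_top,
      ENNReal.toReal_ofNat] at h1
    exact (ENNReal.rpow_lt_top_iff_of_pos (by norm_num : (0 : ℝ) < 1 / 3)).1 h1
  -- superlevel sets of `v'(1)` on `B(0,ρ)`, `ρ ≤ 1`, against `∫_{B(x₀,R'ρ)} |v(t₀)|³`
  have hterm : ∀ ρ : ℝ, 0 < ρ → ρ ≤ 1 → ∀ a : ℝ, 0 < a →
      ENNReal.ofReal (a ^ 3) *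
          (volume.restrict (ball z₁.2 ρ)) {y : EuclideanSpace ℝ (Fin 3) | a < ‖v' 1 y‖} ≤
        ENNReal.ofReal (α ^ 3) * ENNReal.ofReal (R' ^ 3)⁻¹ *
          ∫⁻ x in ball z₀.2 (R' * ρ), ‖v z₀.1 x‖ₑ ^ (3 : ℝ) := by
    intro ρ hρ hρ1 a ha
    have e0 : z₁.2 = 0 := rfl
    have hset : (volume.restrict (ball (0 : EuclideanSpace ℝ (Fin 3)) ρ))
          {y : EuclideanSpace ℝ (Fin 3) | a < ‖v' 1 y‖} =
        ENNReal.ofReal (R' ^ 3)⁻¹ *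
          (volume.restrict (ball z₀.2 (R' * ρ)))
            {x : EuclideanSpace ℝ (Fin 3) | a / α < ‖v z₀.1 x‖} := by
      have h1 := restrict_ball_superlevel_dilate hα hR' z₀.2 (v (tb + β * 1)) a ρ
      rw [htb1] at h1
      rw [← h1]
      congr 1
      ext y
      rw [mem_setOf_eq, mem_setOf_eq, hv'ap, htb1]
    have hsubB : ball z₀.2 (R' * ρ) ⊆ ball z₀.2 R :=
      ball_subset_ball ((mul_le_of_le_one_right hR'.le hρ1).trans hR'R)
    have hmeasv : AEStronglyMeasurable (v z₀.1) (volume.restrict (ball z₀.2 (R' * ρ))) :=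
      hL3.1.mono_measure (Measure.restrict_mono hsubB le_rfl)
    have hcheb := ofReal_pow_mul_restrict_superlevel_le_lintegral hmeasv (div_pos ha hα)
    have ha3 : a ^ 3 = α ^ 3 * (a / α) ^ 3 := by
      field_simp
    rw [e0, hset, ha3, ENNReal.ofReal_mul (by positivity)]
    calc ENNReal.ofReal (α ^ 3) * ENNReal.ofReal ((a / α) ^ 3) * (ENNReal.ofReal (R' ^ 3)⁻¹ *
          (volume.restrict (ball z₀.2 (R' * ρ))) {x : EuclideanSpace ℝ (Fin 3) | a / α < ‖v z₀.1 x‖})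
        = ENNReal.ofReal (α ^ 3) * ENNReal.ofReal (R' ^ 3)⁻¹ * (ENNReal.ofReal ((a / α) ^ 3) *
          (volume.restrict (ball z₀.2 (R' * ρ))) {x : EuclideanSpace ℝ (Fin 3) | a / α < ‖v z₀.1 x‖}) := by
          ring
      _ ≤ ENNReal.ofReal (α ^ 3) * ENNReal.ofReal (R' ^ 3)⁻¹ *
          ∫⁻ x in ball z₀.2 (R' * ρ), ‖v z₀.1 x‖ₑ ^ (3 : ℝ) := by gcongr
  have hA : ∃ A : ℝ, ∀ a : ℝ, 0 < a →
      ENNReal.ofReal (a ^ 3) *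
          (volume.restrict (ball z₁.2 1)) {y : EuclideanSpace ℝ (Fin 3) | a < ‖v' 1 y‖} ≤
        ENNReal.ofReal A := by
    set A' : ℝ≥0∞ := ENNReal.ofReal (α ^ 3) * ENNReal.ofReal (R' ^ 3)⁻¹ *
      ∫⁻ x in ball z₀.2 R, ‖v z₀.1 x‖ₑ ^ (3 : ℝ) with hA'
    have hA'top : A' ≠ ⊤ :=
      ENNReal.mul_ne_top (ENNReal.mul_ne_top ENNReal.ofReal_ne_top ENNReal.ofReal_ne_top) hL3fin.ne
    refine ⟨A'.toReal, fun a ha => ?_⟩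
    rw [ENNReal.ofReal_toReal hA'top]
    refine (hterm 1 one_pos le_rfl a ha).trans ?_
    rw [mul_one, hA']
    gcongr
  have hvanish : ∀ δ : ℝ, 0 < δ → ∃ r : ℝ, 0 < r ∧ ∀ a : ℝ, 0 < a →
      ENNReal.ofReal (a ^ 3) *
          (volume.restrict (ball z₁.2 r)) {y : EuclideanSpace ℝ (Fin 3) | a < ‖v' 1 y‖} ≤
        ENNReal.ofReal (δ ^ 3) := by
    intro δ hδ
    -- absolute continuity of `∫ |v(t₀)|³` on `B(x₀,R)` and `|B(x₀,r)| → 0`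
    have hne : ∫⁻ x, ‖v z₀.1 x‖ₑ ^ (3 : ℝ) ∂(volume.restrict (ball z₀.2 R)) ≠ ⊤ := hL3fin.ne
    have hη : ENNReal.ofReal (ν ^ 3 * δ ^ 3) ≠ 0 := (ENNReal.ofReal_pos.2 (by positivity)).ne'
    obtain ⟨η, hηpos, hηlt⟩ := exists_pos_setLIntegral_lt_of_measure_lt hne hη
    have hballT : Tendsto (fun r : ℝ => volume (ball z₀.2 r)) (𝓝[>] 0) (𝓝 0) := by
      have h1 := tendsto_measure_thickening (μ := (volume : Measure (EuclideanSpace ℝ (Fin 3))))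
        (s := ({z₀.2} : Set (EuclideanSpace ℝ (Fin 3))))
        ⟨1, one_pos, by rw [thickening_singleton]; exact measure_ball_lt_top.ne⟩
      rw [closure_singleton, measure_singleton] at h1
      simpa only [thickening_singleton] using h1
    have hev : ∀ᶠ r : ℝ in 𝓝[>] 0, volume (ball z₀.2 r) < η ∧ r ∈ Ioo (0 : ℝ) R' := by
      refine (hballT.eventually (gt_mem_nhds hηpos)).and ?_
      exact Ioo_mem_nhdsGT hR'
    obtain ⟨r₁, hr₁η, hr₁⟩ := hev.exists
    refine ⟨r₁ / R', div_pos hr₁.1 hR', fun a ha => ?_⟩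
    have hρ1 : r₁ / R' ≤ 1 := (div_le_one hR').2 hr₁.2.le
    refine (hterm (r₁ / R') (div_pos hr₁.1 hR') hρ1 a ha).trans ?_
    rw [mul_div_cancel₀ _ hR'.ne']
    have hsubB : ball z₀.2 r₁ ⊆ ball z₀.2 R := ball_subset_ball (hr₁.2.le.trans hR'R)
    have hint : ∫⁻ x in ball z₀.2 r₁, ‖v z₀.1 x‖ₑ ^ (3 : ℝ) < ENNReal.ofReal (ν ^ 3 * δ ^ 3) := by
      have h1 := hηlt (ball z₀.2 r₁) ((Measure.restrict_apply_le _ _).trans_lt hr₁η)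
      rwa [Measure.restrict_restrict measurableSet_ball, inter_eq_left.2 hsubB] at h1
    calc ENNReal.ofReal (α ^ 3) * ENNReal.ofReal (R' ^ 3)⁻¹ *
          ∫⁻ x in ball z₀.2 r₁, ‖v z₀.1 x‖ₑ ^ (3 : ℝ)
        ≤ ENNReal.ofReal (α ^ 3) * ENNReal.ofReal (R' ^ 3)⁻¹ * ENNReal.ofReal (ν ^ 3 * δ ^ 3) := by
          gcongr
      _ = ENNReal.ofReal (δ ^ 3) := by
          rw [← ENNReal.ofReal_mul (by positivity), ← ENNReal.ofReal_mul (by positivity)]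
          congr 1
          rw [hαdef]
          field_simp
  -- (9) the unit viscosity fact at `x* = 0`, `R = 1/2`, `M'`
  have hreg := h (0 : EuclideanSpace ℝ (Fin 3)) (1 / 2) M' (by norm_num) (by norm_num) hM'pos
    v' q' hball hbdd' hwc' hseq' hA hvanish
  -- (10) back to `v`: `Q((1,0),ρ) = Φ⁻¹(]t₀ − βρ², t₀[ × B(x₀, R'ρ)) ⊇ Φ⁻¹(Q(z₀, ρ min(R',√β)))`
  obtain ⟨ρ, hρ, hρfin⟩ : ∃ ρ : ℝ, 0 < ρ ∧
      eLpNorm (uncurry v') ⊤ (volume.restrict (parabolicCylinder ρ z₁)) ≠ ⊤ := by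
    by_contra hcon
    exact hreg fun r hr => by
      by_contra hne
      exact hcon ⟨r, hr, hne⟩
  have hpreS : stAffine β R' tb z₀.2 ⁻¹' (Ioo (z₀.1 - β * ρ ^ 2) z₀.1 ×ˢ ball z₀.2 (R' * ρ)) =
      parabolicCylinder ρ z₁ := by
    have e1 : (z₀.1 - β * ρ ^ 2 - tb) / β = z₁.1 - ρ ^ 2 := by
      rw [htbdef, hz₁]
      field_simp
      ring
    have e2 : (z₀.1 - tb) / β = z₁.1 := by
      rw [htbdef, sub_sub_cancel, div_self hβ.ne']
    have e3 : R'⁻¹ • (z₀.2 - z₀.2) = z₁.2 := by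
      rw [sub_self, smul_zero]
    have e4 : R' * ρ / R' = ρ := mul_div_cancel_left₀ ρ hR'.ne'
    rw [stAffine_preimage_cylinder hβ hR' tb z₀.2 z₀.2, e1, e2, e3, e4, parabolicCylinder]
  rw [← hpreS, hv', eLpNorm_top_smul_stPull_preimage hβ hR' tb z₀.2 α v] at hρfin
  have hS : eLpNorm (uncurry v) ⊤
      (volume.restrict (Ioo (z₀.1 - β * ρ ^ 2) z₀.1 ×ˢ ball z₀.2 (R' * ρ))) < ⊤ := by
    have hα0 : ‖α‖ₑ ≠ 0 := by simp [hα.ne']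
    refine lt_top_iff_ne_top.2 fun heq => hρfin ?_
    rw [heq, ENNReal.mul_top hα0]
  set r₀ : ℝ := ρ * min R' (Real.sqrt β) with hr₀
  have hr₀pos : 0 < r₀ := mul_pos hρ (lt_min hR' (Real.sqrt_pos.2 hβ))
  have hsubS : parabolicCylinder r₀ z₀ ⊆ Ioo (z₀.1 - β * ρ ^ 2) z₀.1 ×ˢ ball z₀.2 (R' * ρ) := by
    rw [parabolicCylinder]
    refine prod_mono (Ioo_subset_Ioo ?_ le_rfl) (ball_subset_ball ?_)
    · have h1 : r₀ ^ 2 ≤ β * ρ ^ 2 := by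
        rw [hr₀, mul_pow]
        have h2 : (min R' (Real.sqrt β)) ^ 2 ≤ Real.sqrt β ^ 2 :=
          pow_le_pow_left₀ (le_min hR'.le (Real.sqrt_nonneg β)) (min_le_right _ _) 2
        rw [Real.sq_sqrt hβ.le] at h2
        calc ρ ^ 2 * (min R' (Real.sqrt β)) ^ 2 ≤ ρ ^ 2 * β := by gcongr
          _ = β * ρ ^ 2 := mul_comm _ _
      linarith
    · rw [hr₀, mul_comm]
      exact mul_le_mul_of_nonneg_right (min_le_left _ _) hρ.le
  exact ⟨r₀, hr₀pos,
    (eLpNorm_mono_measure (uncurry v) (Measure.restrict_mono hsubS le_rfl)).trans_lt hS⟩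

end Viscosity

end Literature.Analysis.FluidPDE

end
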